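import Literature.NumberTheory.EllipticCurves.SupersingularModPDecompositionImageProofs
import Literature.NumberTheory.EllipticCurves.DivisionField
import Literature.NumberTheory.GaloisRepresentations.ArtinReciprocityCharacterFiniteProofs
import Literature.NumberTheory.NumberFields.ArtinMapDecompositionInertia
import Literature.NumberTheory.NumberFields.InertiaGeneratesGalois
import HarnessLib

/-!
# The `2`-division field of a curve with good supersingular reduction at `2` has exactly ONE prime above `2`
# (Serre 1972, §1.11 Prop. 12 (d) at `p = 2`: the decomposition group fills `GL₂(𝔽₂)`)

`Proofs`-style file (theorems only: no definition, no named fact, no `sorry`), topic `NumberTheory/EllipticCurves`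
(dot-notation namespace `WeierstrassCurve`, as `DivisionField.lean`), written by the prover seat `bsd-wall-rtt-p4-w2` g20 (cell
`bsd-wall`; `--supports` stmt-BirchSwinnertonDyer-21438, line `nonsquare-descent`; closes nothing; BSD is proved for no curve here).

For an elliptic curve `W/ℚ` with good SUPERSINGULAR reduction at `2` (`2 ∣ a₂(W)`), Serre's Prop. 12 (d) (tree
`serre1972_supersingular_decompositionSubgroup_image_holds`, all `p`) says that the decomposition group `D_𝔓 ≤ Γ_ℚ` of a prime
`𝔓 ∣ 2` of `ℤ̄` acts on `W[2]` through a group of order `2(2² − 1) = 6 = #GL₂(𝔽₂)`.  Hence `D_𝔓` maps ONTO `Gal(ℚ(W[2])/ℚ) ↪ GL₂(𝔽₂)`, i.e.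
the prime `𝔓 ∩ ℚ(W[2])` is fixed by the whole Galois group, and since `Gal(ℚ(W[2])/ℚ)` permutes the primes above `2` transitively:

* **`WeierstrassCurve.existsUnique_prime_divisionField_two_of_dvd_frobeniusTraceAt`** — `𝓞_{ℚ(W[2])}` has EXACTLY ONE prime above `2`
  (in the tree's shape `∃! w : HeightOneSpectrum (𝓞 ℚ(W[2])), (2 : 𝓞 ℚ(W[2])) ∈ w`, the hypothesis `hv` of the `μ`-doors
  `FineSelmerMuRoadDoors` and of `IwasawaTheory.ker_classGroupNorm_layer_eq_closure_of_totallyRamifiedFrom_zero` for `K = ℚ(W[2])`).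

* **`WeierstrassCurve.finrank_divisionField_two_eq_six_of_dvd_frobeniusTraceAt`** — `[ℚ(W[2]) : ℚ] = 6` (`ρ̄_{W,2}` is onto `GL₂(𝔽₂)`:
  already the decomposition group has `6` elements); **`WeierstrassCurve.ramificationIdx_divisionField_two_eq_three_of_dvd_frobeniusTraceAt`** —
  the prime of `ℚ(W[2])` above `2` has `e = 3` over `ℤ` (Prop. 12 (c): inertia acts through a cyclic group of order `2² − 1 = 3`; so `f = 2`).

This is special to `p = 2` (`#GL₂(𝔽_p) = (p²−1)(p²−p) > 2(p²−1)` for `p > 2`).  It is the input «`𝔓` is the unique prime of `M_n` over `2`»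
of the line card `Cruxes/SignedMuSeedAtTwoPlus/Lines/nonsquare-descent.md` (habitat: `W` good supersingular at `2`, `a₂ = 0`) at level `0`.

References: [SerreInventiones1972] §1.11 Prop. 12 (c), (d); §2.2; [SilvermanAEC2009] VIII §1 (`ℚ(E[m])/ℚ` Galois), III §7;
[SerreLocalFields1979] Ch. I §7 Prop. 22 (b).
-/

noncomputable section

open scoped NumberField Pointwise
open NumberField IsDedekindDomain Field
open Literature.NumberTheory.EllipticCurves Literature.NumberTheory.GaloisRepresentations

namespace WeierstrassCurve

/-- The map `𝓞 L → ℤ̄_K` is integral (private copy of the tree's helper). [folklore] -/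
private theorem isIntegral_ringOfIntegersToIntegralClosure_div {k : Type} [Field k] [NumberField k]
    (F : IntermediateField k (AlgebraicClosure k)) :
    (ringOfIntegersToIntegralClosure (k := k) (Ω := AlgebraicClosure k) F).IsIntegral := by
  letI : Algebra (𝓞 F) (integralClosure (𝓞 k) (AlgebraicClosure k)) :=
    (ringOfIntegersToIntegralClosure (k := k) (Ω := AlgebraicClosure k) F).toAlgebra
  haveI : IsScalarTower (𝓞 k) (𝓞 F) (integralClosure (𝓞 k) (AlgebraicClosure k)) :=
    IsScalarTower.of_algebraMap_eq (R := 𝓞 k) (S := 𝓞 F)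
      (A := integralClosure (𝓞 k) (AlgebraicClosure k)) fun _ ↦ rfl
  intro x
  change _root_.IsIntegral (𝓞 F) x
  exact (Algebra.IsIntegral.isIntegral (R := 𝓞 k) x).tower_top


/-- Restriction `Γ_K → Gal(E/K)` is onto for `E ⊆ K̄` normal over `K` (private copy of the tree's helper). [folklore] -/
private theorem absRestrictNormalHom_surjective_div {K : Type} [Field K] (E : IntermediateField K (AlgebraicClosure K))
    [Normal K E] : Function.Surjective (absRestrictNormalHom E) := fun g => by
  obtain ⟨σ, hσ⟩ := AlgEquiv.restrictNormalHom_surjective (AlgebraicClosure K) g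
  exact ⟨(Field.absoluteGaloisGroup.toAlgEquiv K).symm σ, hσ⟩

/-- Two height-one primes of `𝓞 ℚ` containing the same rational prime are equal. [folklore] -/
private theorem heightOneSpectrum_rat_eq_of_natCast_mem {p : ℕ} (hp : p.Prime) {u v : HeightOneSpectrum (𝓞 ℚ)}
    (hu : ((p : ℕ) : 𝓞 ℚ) ∈ u.asIdeal) (hv : ((p : ℕ) : 𝓞 ℚ) ∈ v.asIdeal) : u = v := by
  have key : ∀ w : HeightOneSpectrum (𝓞 ℚ), ((p : ℕ) : 𝓞 ℚ) ∈ w.asIdeal → Rat.HeightOneSpectrum.natGenerator w = p := by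
    intro w hw
    have hdvd : Rat.HeightOneSpectrum.natGenerator w ∣ p := by
      rw [Rat.HeightOneSpectrum.natGenerator_dvd_iff]
      have : ((p : ℕ) : ℤ) = Rat.IsIntegralClosure.intEquiv (𝓞 ℚ) ((p : ℕ) : 𝓞 ℚ) := by rw [map_natCast]
      rw [this]
      exact Ideal.mem_map_of_mem _ hw
    exact (Nat.prime_dvd_prime_iff_eq (Rat.HeightOneSpectrum.prime_natGenerator w) hp).1 hdvd
  apply Rat.HeightOneSpectrum.primesEquiv.injective
  apply Subtype.ext
  change Rat.HeightOneSpectrum.natGenerator u = Rat.HeightOneSpectrum.natGenerator v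
  rw [key u hu, key v hv]

/-- **`ℚ(W[2])` has exactly one prime above `2` when `W` has good supersingular reduction at `2`** (Serre's Prop. 12 (d) at `p = 2`:
the decomposition group of a prime over `2` acts on `W[2]` through all of `GL₂(𝔽₂)`, hence restricts ONTO `Gal(ℚ(W[2])/ℚ)` and fixes the
prime below it, while the primes above `2` form one Galois orbit). [cite: SerreInventiones1972, §1.11 Prop. 12 (d) and §2.2]
[cite: SilvermanAEC2009, VIII §1] -/
theorem existsUnique_prime_divisionField_two_of_dvd_frobeniusTraceAt (W : WeierstrassCurve ℚ) [W.IsElliptic]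
    (v : HeightOneSpectrum (𝓞 ℚ)) (hv : ((2 : ℕ) : 𝓞 ℚ) ∈ v.asIdeal) (hgood : W.HasGoodReductionAt v)
    (hss : (2 : ℤ) ∣ W.frobeniusTraceAt v) :
    haveI : NumberField (W.divisionField 2) := NumberField.mk
    ∃! w : HeightOneSpectrum (𝓞 (W.divisionField 2)), ((2 : ℕ) : 𝓞 (W.divisionField 2)) ∈ w.asIdeal := by
  classical
  haveI : NumberField (W.divisionField 2) := NumberField.mk
  haveI : Fact (Nat.Prime 2) := ⟨Nat.prime_two⟩
  haveI : NeZero ((2 : ℕ) : ℚ) := ⟨by norm_num⟩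
  haveI : v.asIdeal.IsMaximal := v.isMaximal
  set M := W.divisionField 2 with hM
  haveI : IsGalois ℚ M := W.isGalois_divisionField 2
  haveI : FiniteDimensional ℚ M := W.finiteDimensional_divisionField 2
  set ι := ringOfIntegersToIntegralClosure (k := ℚ) (Ω := AlgebraicClosure ℚ) M with hιdef
  -- every height-one prime of `𝓞 M` containing `2` lies over `v`
  have hover : ∀ w : HeightOneSpectrum (𝓞 M), ((2 : ℕ) : 𝓞 M) ∈ w.asIdeal → w.asIdeal.LiesOver v.asIdeal := by
    intro w hw
    have hw0 : w.asIdeal.under (𝓞 ℚ) ≠ ⊥ := mt Ideal.eq_bot_of_comap_eq_bot w.ne_bot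
    haveI : w.asIdeal.IsMaximal := w.isMaximal
    haveI : (w.asIdeal.under (𝓞 ℚ)).IsMaximal := Ideal.IsMaximal.under (𝓞 ℚ) w.asIdeal
    have h2 : ((2 : ℕ) : 𝓞 ℚ) ∈ w.asIdeal.under (𝓞 ℚ) := by
      rw [Ideal.under_def, Ideal.mem_comap, map_natCast]; exact hw
    have heq := heightOneSpectrum_rat_eq_of_natCast_mem Nat.prime_two
      (u := ⟨w.asIdeal.under (𝓞 ℚ), Ideal.IsMaximal.isPrime ‹_›, hw0⟩) (v := v) h2 hv
    exact ⟨(congrArg HeightOneSpectrum.asIdeal heq).symm⟩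
  -- existence
  obtain ⟨Q, hQmax, hQv⟩ := Ideal.exists_maximal_ideal_liesOver_of_isIntegral (S := 𝓞 M) v.asIdeal
  have hQ0 : Q ≠ ⊥ := Ring.ne_bot_of_isMaximal_of_not_isField hQmax (RingOfIntegers.not_isField M)
  let w₀ : HeightOneSpectrum (𝓞 M) := ⟨Q, hQmax.isPrime, hQ0⟩
  have hw₀ : ((2 : ℕ) : 𝓞 M) ∈ w₀.asIdeal := by
    have h := hv
    rw [hQv.over, Ideal.under_def, Ideal.mem_comap, map_natCast] at h
    exact h
  refine ⟨w₀, hw₀, fun w hw => ?_⟩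
  -- uniqueness: `w` and `w₀` lie over `v`; a framed `ρ̄ = ρ̄_{W,2}`
  haveI := hover w hw
  haveI := hover w₀ hw₀
  obtain ⟨ρ, hρ⟩ := exists_isTorsionGaloisRep W 2
  obtain ⟨e, he⟩ := id hρ
  -- `ker ρ̄ ≤ ker (Γ_ℚ → Gal(M/ℚ))`
  have hker : ∀ σ : absoluteGaloisGroup ℚ, ρ.toMonoidHom σ = 1 → absRestrictNormalHom M σ = 1 := by
    intro σ hσ
    refine (W.absRestrictNormalHom_divisionField_eq_one_iff 2 σ).mpr fun T => ?_
    apply e.injective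
    have h1 : ((ρ σ : GL (Fin 2) (ZMod 2)) : Matrix (Fin 2) (Fin 2) (ZMod 2)) = 1 := by
      have : ρ σ = 1 := hσ
      rw [this, Units.val_one]
    rw [he σ T, h1, Matrix.one_mulVec]
  -- a prime `𝔓` of `ℤ̄` above `w₀`, and Serre's count at `𝔓`
  letI algι : Algebra (𝓞 M) (absIntegers (𝓞 ℚ) ℚ) := ι.toAlgebra
  haveI : Algebra.IsIntegral (𝓞 M) (absIntegers (𝓞 ℚ) ℚ) := ⟨isIntegral_ringOfIntegersToIntegralClosure_div M⟩
  haveI : IsScalarTower (𝓞 ℚ) (𝓞 M) (absIntegers (𝓞 ℚ) ℚ) :=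
    IsScalarTower.of_algebraMap_eq (R := 𝓞 ℚ) (S := 𝓞 M) (A := absIntegers (𝓞 ℚ) ℚ) fun _ ↦ rfl
  haveI : FaithfulSMul (𝓞 M) (absIntegers (𝓞 ℚ) ℚ) :=
    (faithfulSMul_iff_algebraMap_injective (𝓞 M) (absIntegers (𝓞 ℚ) ℚ)).mpr (ringOfIntegersToIntegralClosure_injective M)
  haveI : w₀.asIdeal.IsMaximal := w₀.isMaximal
  obtain ⟨𝔓, h𝔓max, h𝔓w⟩ := Ideal.exists_maximal_ideal_liesOver_of_isIntegral (S := absIntegers (𝓞 ℚ) ℚ) w₀.asIdeal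
  have h𝔓v : 𝔓 ∈ v.primesAbove := by
    refine ⟨h𝔓max.isPrime, ⟨?_⟩⟩
    rw [Ideal.LiesOver.over (P := w₀.asIdeal) (p := v.asIdeal), h𝔓w.over, Ideal.under_under]
  obtain ⟨-, -, hD⟩ := serre1972_supersingular_decompositionSubgroup_image_holds W 2 v hv hgood hss ρ hρ 𝔓 h𝔓v
  -- `ρ̄(D) = ρ̄(Γ_ℚ)`: both have at most `#GL₂(𝔽₂) = 6` elements
  set D := 𝔓.decompositionSubgroup (absoluteGaloisGroup ℚ) with hDdef
  have hGL : Nat.card (GL (Fin 2) (ZMod 2)) = 6 := by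
    rw [Matrix.card_GL_field, ZMod.card, Fin.prod_univ_two]
    norm_num
  have hrange : D.map ρ.toMonoidHom = ρ.toMonoidHom.range := by
    refine Subgroup.eq_of_le_of_card_ge (Subgroup.map_le_range _ _) ?_
    rw [hD]
    calc Nat.card ρ.toMonoidHom.range ≤ Nat.card (GL (Fin 2) (ZMod 2)) := Subgroup.card_le_card_group _
      _ = 2 * (2 ^ 2 - 1) := by rw [hGL]; norm_num
  -- a prime `𝔓'` of `ℤ̄` above `w`; `Γ_ℚ` permutes the primes above `v` transitively: `g • 𝔓 = 𝔓'`
  haveI : w.asIdeal.IsMaximal := w.isMaximal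
  obtain ⟨𝔓', h𝔓'max, h𝔓'w⟩ := Ideal.exists_maximal_ideal_liesOver_of_isIntegral (S := absIntegers (𝓞 ℚ) ℚ) w.asIdeal
  have h𝔓'v : 𝔓' ∈ v.primesAbove := by
    refine ⟨h𝔓'max.isPrime, ⟨?_⟩⟩
    rw [Ideal.LiesOver.over (P := w.asIdeal) (p := v.asIdeal), h𝔓'w.over, Ideal.under_under]
  obtain ⟨g, hg⟩ := HeightOneSpectrum.exists_smul_eq_of_mem_primesAbove_holds (K := ℚ) (v := v) h𝔓v h𝔓'v
  -- move `g` into `D` modulo `ker ρ̄`: `g = k d` with `ρ̄ k = 1`, `d ∈ D`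
  have hmem : ρ.toMonoidHom g ∈ D.map ρ.toMonoidHom := by rw [hrange]; exact ⟨g, rfl⟩
  obtain ⟨d, hdD, hd⟩ := hmem
  have hk : ρ.toMonoidHom (g * d⁻¹) = 1 := by rw [map_mul, map_inv, ← hd, mul_inv_cancel]
  have hkM : absRestrictNormalHom M (g * d⁻¹) = 1 := hker _ hk
  -- `d • 𝔓 = 𝔓`, and `g d⁻¹` fixes `𝓞 M` pointwise
  have hd𝔓 : d • 𝔓 = 𝔓 := (Ideal.mem_decompositionSubgroup_iff (G := absoluteGaloisGroup ℚ)).mp hdD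
  have hfixed : ∀ y : 𝓞 M, (g * d⁻¹) • algebraMap (𝓞 M) (absIntegers (𝓞 ℚ) ℚ) y =
      algebraMap (𝓞 M) (absIntegers (𝓞 ℚ) ℚ) y := by
    intro y
    have h := ringOfIntegersToIntegralClosure_absRestrictNormalHom_smul M (g * d⁻¹) y
    rw [hkM, one_smul] at h
    exact h.symm
  -- hence `w = 𝔓' ∩ 𝓞 M = (g • 𝔓) ∩ 𝓞 M = 𝔓 ∩ 𝓞 M = w₀`
  apply HeightOneSpectrum.ext
  rw [h𝔓'w.over, h𝔓w.over]
  ext y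
  rw [Ideal.under_def, Ideal.under_def, Ideal.mem_comap, Ideal.mem_comap, ← hg, Ideal.mem_pointwise_smul_iff_inv_smul_mem]
  have h3 : g⁻¹ = d⁻¹ * (g * d⁻¹)⁻¹ := by rw [mul_inv_rev, inv_inv, inv_mul_cancel_left]
  have h4 : (g * d⁻¹)⁻¹ • algebraMap (𝓞 M) (absIntegers (𝓞 ℚ) ℚ) y = algebraMap (𝓞 M) (absIntegers (𝓞 ℚ) ℚ) y :=
    inv_smul_eq_iff.mpr (hfixed y).symm
  rw [h3, mul_smul, h4, ← Ideal.mem_pointwise_smul_iff_inv_smul_mem, hd𝔓]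

/-! ### Degree `6` and ramification index `3` -/

/-- `[L : K] = [Γ_K : ker(Γ_K → Gal(L/K))]` for `L ⊆ K̄` finite Galois over `K`. [folklore] -/
private theorem index_ker_absRestrictNormalHom_eq_finrank {K : Type} [Field K] (L : IntermediateField K (AlgebraicClosure K))
    [FiniteDimensional K L] [IsGalois K L] : (absRestrictNormalHom L).ker.index = Module.finrank K L := by
  rw [Subgroup.index_ker, MonoidHom.range_eq_top.mpr (absRestrictNormalHom_surjective_div L), Subgroup.card_top,
    IsGalois.card_aut_eq_finrank]

/-- `e(𝔓 ∩ 𝓞_L | K) = #(I_𝔓|_L)` for `L ⊆ K̄` finite Galois over the number field `K` and a prime `𝔓` of `ℤ̄_K` (Serre, *Local Fields* I §7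
Prop. 22 (b), tree `inertia_comap_ringOfIntegers_eq_map_absRestrictNormalHom`, with `#I = e`). [cite: SerreLocalFields1979, Ch. I §7 Prop. 22(b)] -/
private theorem ramificationIdx_comap_eq_card_map_inertia {K : Type} [Field K] [NumberField K]
    (L : IntermediateField K (AlgebraicClosure K)) [FiniteDimensional K L] [NumberField L] [IsGalois K L]
    (𝔓 : Ideal (absIntegers (𝓞 K) K)) [𝔓.IsPrime]
    [(𝔓.comap (ringOfIntegersToIntegralClosure (k := K) (Ω := AlgebraicClosure K) L)).IsMaximal] :
    (𝔓.comap (ringOfIntegersToIntegralClosure (k := K) (Ω := AlgebraicClosure K) L)).ramificationIdx (𝓞 K) =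
      Nat.card ((𝔓.inertia (absoluteGaloisGroup K)).map (absRestrictNormalHom L)) := by
  rw [← Literature.NumberTheory.NumberFields.inertia_comap_ringOfIntegers_eq_map_absRestrictNormalHom L 𝔓]
  exact (Literature.NumberTheory.NumberFields.card_inertia_eq_ramificationIdx L (L ≃ₐ[K] L) K _).symm

/-- A prime of `𝓞 ℚ` containing `2` is unramified over `ℤ` (`d_ℚ = 1`). [folklore] -/
private theorem ramificationIdx_int_eq_one_of_two_mem (v : HeightOneSpectrum (𝓞 ℚ)) (hv : ((2 : ℕ) : 𝓞 ℚ) ∈ v.asIdeal) :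
    v.asIdeal.ramificationIdx ℤ = 1 := by
  have hunr : Algebra.IsUnramifiedIn (𝓞 ℚ) (Ideal.span {(2 : ℤ)}) :=
    (NumberField.not_dvd_discr_iff_isUnramifiedIn ℚ (𝓞 ℚ) Int.prime_two).mp (by rw [Rat.numberField_discr]; norm_num)
  haveI : v.asIdeal.IsPrime := v.isPrime
  have hlies : v.asIdeal.LiesOver (Ideal.span {(2 : ℤ)}) := by
    rw [Ideal.liesOver_span_iff v.isPrime.ne_top Int.prime_two, map_ofNat]
    exact_mod_cast hv
  exact hunr.ramificationIdx_eq_one hlies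

/-- **Serre's Prop. 12 for the `2`-division field: common set-up.**  For `W/ℚ` good supersingular at `2` and a prime `w ∣ 2` of `M = ℚ(W[2])`:
the kernel of `Γ_ℚ → Gal(M/ℚ)` is the kernel of `ρ̄_{W,2}`, `[M : ℚ] = 6` and `e(w | 𝓞 ℚ) = 3`. [cite: SerreInventiones1972, §1.11 Prop. 12 (c), (d)] -/
private theorem finrank_eq_six_and_ramificationIdx_eq_three (W : WeierstrassCurve ℚ) [W.IsElliptic]
    (v : HeightOneSpectrum (𝓞 ℚ)) (hv : ((2 : ℕ) : 𝓞 ℚ) ∈ v.asIdeal) (hgood : W.HasGoodReductionAt v)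
    (hss : (2 : ℤ) ∣ W.frobeniusTraceAt v) :
    haveI : NumberField (W.divisionField 2) := NumberField.mk
    Module.finrank ℚ (W.divisionField 2) = 6 ∧
      ∀ w : HeightOneSpectrum (𝓞 (W.divisionField 2)), ((2 : ℕ) : 𝓞 (W.divisionField 2)) ∈ w.asIdeal →
        w.asIdeal.ramificationIdx (𝓞 ℚ) = 3 := by
  classical
  haveI : NumberField (W.divisionField 2) := NumberField.mk
  haveI : Fact (Nat.Prime 2) := ⟨Nat.prime_two⟩
  haveI : NeZero ((2 : ℕ) : ℚ) := ⟨by norm_num⟩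
  haveI : v.asIdeal.IsMaximal := v.isMaximal
  set M := W.divisionField 2 with hM
  haveI : IsGalois ℚ M := W.isGalois_divisionField 2
  haveI : FiniteDimensional ℚ M := W.finiteDimensional_divisionField 2
  set ι := ringOfIntegersToIntegralClosure (k := ℚ) (Ω := AlgebraicClosure ℚ) M with hιdef
  obtain ⟨ρ, hρ⟩ := exists_isTorsionGaloisRep W 2
  obtain ⟨e, he⟩ := id hρ
  -- `ker ρ̄ = ker (Γ_ℚ → Gal(M/ℚ))`
  have hker_eq : ρ.toMonoidHom.ker = (absRestrictNormalHom M).ker := by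
    ext σ
    rw [MonoidHom.mem_ker, MonoidHom.mem_ker, W.absRestrictNormalHom_divisionField_eq_one_iff 2 σ]
    constructor
    · intro hσ T
      apply e.injective
      have h1 : ((ρ σ : GL (Fin 2) (ZMod 2)) : Matrix (Fin 2) (Fin 2) (ZMod 2)) = 1 := by
        have : ρ σ = 1 := hσ
        rw [this, Units.val_one]
      rw [he σ T, h1, Matrix.one_mulVec]
    · intro hσ
      have hmat : ((ρ σ : GL (Fin 2) (ZMod 2)) : Matrix (Fin 2) (Fin 2) (ZMod 2)) = 1 := by
        refine Matrix.toLin'.injective (LinearMap.ext fun x => ?_)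
        rw [Matrix.toLin'_apply, Matrix.toLin'_apply, Matrix.one_mulVec]
        obtain ⟨T, rfl⟩ := e.surjective x
        rw [← he σ T, hσ T]
      exact Units.ext hmat
  -- every prime of `𝓞 M` containing `2` lies over `v`
  have hover : ∀ w : HeightOneSpectrum (𝓞 M), ((2 : ℕ) : 𝓞 M) ∈ w.asIdeal → w.asIdeal.LiesOver v.asIdeal := by
    intro w hw
    have hw0 : w.asIdeal.under (𝓞 ℚ) ≠ ⊥ := mt Ideal.eq_bot_of_comap_eq_bot w.ne_bot
    haveI : w.asIdeal.IsMaximal := w.isMaximal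
    haveI : (w.asIdeal.under (𝓞 ℚ)).IsMaximal := Ideal.IsMaximal.under (𝓞 ℚ) w.asIdeal
    have h2 : ((2 : ℕ) : 𝓞 ℚ) ∈ w.asIdeal.under (𝓞 ℚ) := by
      rw [Ideal.under_def, Ideal.mem_comap, map_natCast]; exact hw
    have heq := heightOneSpectrum_rat_eq_of_natCast_mem Nat.prime_two
      (u := ⟨w.asIdeal.under (𝓞 ℚ), Ideal.IsMaximal.isPrime ‹_›, hw0⟩) (v := v) h2 hv
    exact ⟨(congrArg HeightOneSpectrum.asIdeal heq).symm⟩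
  -- a prime of `𝓞 M` over `v` and a prime `𝔓` of `ℤ̄` above it; Serre at `𝔓`
  letI algι : Algebra (𝓞 M) (absIntegers (𝓞 ℚ) ℚ) := ι.toAlgebra
  haveI : Algebra.IsIntegral (𝓞 M) (absIntegers (𝓞 ℚ) ℚ) := ⟨isIntegral_ringOfIntegersToIntegralClosure_div M⟩
  haveI : IsScalarTower (𝓞 ℚ) (𝓞 M) (absIntegers (𝓞 ℚ) ℚ) :=
    IsScalarTower.of_algebraMap_eq (R := 𝓞 ℚ) (S := 𝓞 M) (A := absIntegers (𝓞 ℚ) ℚ) fun _ ↦ rfl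
  haveI : FaithfulSMul (𝓞 M) (absIntegers (𝓞 ℚ) ℚ) :=
    (faithfulSMul_iff_algebraMap_injective (𝓞 M) (absIntegers (𝓞 ℚ) ℚ)).mpr (ringOfIntegersToIntegralClosure_injective M)
  have hlift : ∀ w : HeightOneSpectrum (𝓞 M), ((2 : ℕ) : 𝓞 M) ∈ w.asIdeal →
      ∃ 𝔓 : Ideal (absIntegers (𝓞 ℚ) ℚ), 𝔓.IsMaximal ∧ 𝔓.LiesOver w.asIdeal ∧ 𝔓 ∈ v.primesAbove := by
    intro w hw
    haveI := hover w hw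
    haveI : w.asIdeal.IsMaximal := w.isMaximal
    obtain ⟨𝔓, h𝔓max, h𝔓w⟩ := Ideal.exists_maximal_ideal_liesOver_of_isIntegral (S := absIntegers (𝓞 ℚ) ℚ) w.asIdeal
    refine ⟨𝔓, h𝔓max, h𝔓w, h𝔓max.isPrime, ⟨?_⟩⟩
    rw [Ideal.LiesOver.over (P := w.asIdeal) (p := v.asIdeal), h𝔓w.over, Ideal.under_under]
  obtain ⟨Q, hQmax, hQv⟩ := Ideal.exists_maximal_ideal_liesOver_of_isIntegral (S := 𝓞 M) v.asIdeal
  have hQ0 : Q ≠ ⊥ := Ring.ne_bot_of_isMaximal_of_not_isField hQmax (RingOfIntegers.not_isField M)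
  let w₀ : HeightOneSpectrum (𝓞 M) := ⟨Q, hQmax.isPrime, hQ0⟩
  have hw₀ : ((2 : ℕ) : 𝓞 M) ∈ w₀.asIdeal := by
    have h := hv
    rw [hQv.over, Ideal.under_def, Ideal.mem_comap, map_natCast] at h
    exact h
  obtain ⟨𝔓, h𝔓max, h𝔓w, h𝔓v⟩ := hlift w₀ hw₀
  obtain ⟨-, -, hD⟩ := serre1972_supersingular_decompositionSubgroup_image_holds W 2 v hv hgood hss ρ hρ 𝔓 h𝔓v
  have hGL : Nat.card (GL (Fin 2) (ZMod 2)) = 6 := by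
    rw [Matrix.card_GL_field, ZMod.card, Fin.prod_univ_two]
    norm_num
  have hrange : (𝔓.decompositionSubgroup (absoluteGaloisGroup ℚ)).map ρ.toMonoidHom = ρ.toMonoidHom.range := by
    refine Subgroup.eq_of_le_of_card_ge (Subgroup.map_le_range _ _) ?_
    rw [hD]
    calc Nat.card ρ.toMonoidHom.range ≤ Nat.card (GL (Fin 2) (ZMod 2)) := Subgroup.card_le_card_group _
      _ = 2 * (2 ^ 2 - 1) := by rw [hGL]; norm_num
  refine ⟨?_, fun w hw => ?_⟩
  · -- `[M : ℚ] = [Γ_ℚ : ker] = #ρ̄(Γ_ℚ) = 6`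
    rw [← index_ker_absRestrictNormalHom_eq_finrank M, ← hker_eq, Subgroup.index_ker, ← hrange, hD]
    norm_num
  · -- `e(w | 𝓞 ℚ) = #(I_𝔓'|_M) = #ρ̄(I_𝔓') = 3` for a prime `𝔓'` of `ℤ̄` above `w`
    obtain ⟨𝔓', h𝔓'max, h𝔓'w, h𝔓'v⟩ := hlift w hw
    haveI : 𝔓'.IsPrime := h𝔓'max.isPrime
    obtain ⟨-, hI, -⟩ := serre1972_supersingular_decompositionSubgroup_image_holds W 2 v hv hgood hss ρ hρ 𝔓' h𝔓'v
    haveI : w.asIdeal.IsMaximal := w.isMaximal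
    have hcomap : 𝔓'.comap ι = w.asIdeal := by rw [h𝔓'w.over, Ideal.under_def]; rfl
    haveI : (𝔓'.comap (ringOfIntegersToIntegralClosure (k := ℚ) (Ω := AlgebraicClosure ℚ) M)).IsMaximal := by
      rw [← hιdef, hcomap]; exact w.isMaximal
    have h1 := ramificationIdx_comap_eq_card_map_inertia M 𝔓'
    rw [← hιdef] at h1
    rw [hcomap] at h1
    have h2 : Nat.card ((𝔓'.inertia (absoluteGaloisGroup ℚ)).map (absRestrictNormalHom M)) =
        Nat.card ((𝔓'.inertia (absoluteGaloisGroup ℚ)).map ρ.toMonoidHom) := by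
      rw [← Subgroup.relIndex_ker, ← Subgroup.relIndex_ker, hker_eq]
    rw [h2, hI] at h1
    -- the two sides may carry different (subsingleton) `ℚ`-algebra instance paths
    convert h1 using 3
    · exact Subsingleton.elim _ _
    · norm_num

/-- **`[ℚ(W[2]) : ℚ] = 6`** for `W` good supersingular at `2`: `ρ̄_{W,2} : Gal(ℚ(W[2])/ℚ) ↪ GL₂(𝔽₂)` is onto, since already the decomposition
group at `2` has `2(2² − 1) = 6 = #GL₂(𝔽₂)` elements (Serre Prop. 12 (d)). [cite: SerreInventiones1972, §1.11 Prop. 12 (d) and §2.2]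
[cite: SilvermanAEC2009, III §7] -/
theorem finrank_divisionField_two_eq_six_of_dvd_frobeniusTraceAt (W : WeierstrassCurve ℚ) [W.IsElliptic]
    (v : HeightOneSpectrum (𝓞 ℚ)) (hv : ((2 : ℕ) : 𝓞 ℚ) ∈ v.asIdeal) (hgood : W.HasGoodReductionAt v)
    (hss : (2 : ℤ) ∣ W.frobeniusTraceAt v) : Module.finrank ℚ (W.divisionField 2) = 6 :=
  (finrank_eq_six_and_ramificationIdx_eq_three W v hv hgood hss).1

/-- **`e(𝔭 | 2) = 3` for the prime(s) of `ℚ(W[2])` above `2`**, `W` good supersingular at `2`: the inertia group acts on `W[2]` through a cyclic group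
of order `2² − 1 = 3` (Serre Prop. 12 (c)), and `ℤ → 𝓞 ℚ` is unramified (so `e` over `ℤ` equals `e` over `𝓞 ℚ`); with `[ℚ(W[2]) : ℚ] = 6` and one
prime above `2`, also `f = 2`. [cite: SerreInventiones1972, §1.11 Prop. 12 (c)] [cite: SerreLocalFields1979, Ch. I §7 Prop. 22(b)] -/
theorem ramificationIdx_divisionField_two_eq_three_of_dvd_frobeniusTraceAt (W : WeierstrassCurve ℚ) [W.IsElliptic]
    (v : HeightOneSpectrum (𝓞 ℚ)) (hv : ((2 : ℕ) : 𝓞 ℚ) ∈ v.asIdeal) (hgood : W.HasGoodReductionAt v)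
    (hss : (2 : ℤ) ∣ W.frobeniusTraceAt v) :
    haveI : NumberField (W.divisionField 2) := NumberField.mk
    ∀ w : HeightOneSpectrum (𝓞 (W.divisionField 2)), ((2 : ℕ) : 𝓞 (W.divisionField 2)) ∈ w.asIdeal →
      w.asIdeal.ramificationIdx ℤ = 3 := by
  haveI : NumberField (W.divisionField 2) := NumberField.mk
  intro w hw
  haveI : w.asIdeal.IsMaximal := w.isMaximal
  haveI : v.asIdeal.IsMaximal := v.isMaximal
  have h3 := (finrank_eq_six_and_ramificationIdx_eq_three W v hv hgood hss).2 w hw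
  -- `w` lies over `v`, and `e(v | ℤ) = 1`
  have hw0 : w.asIdeal.under (𝓞 ℚ) ≠ ⊥ := mt Ideal.eq_bot_of_comap_eq_bot w.ne_bot
  haveI : (w.asIdeal.under (𝓞 ℚ)).IsMaximal := Ideal.IsMaximal.under (𝓞 ℚ) w.asIdeal
  have h2 : ((2 : ℕ) : 𝓞 ℚ) ∈ w.asIdeal.under (𝓞 ℚ) := by
    rw [Ideal.under_def, Ideal.mem_comap, map_natCast]; exact hw
  have heq := heightOneSpectrum_rat_eq_of_natCast_mem Nat.prime_two
    (u := ⟨w.asIdeal.under (𝓞 ℚ), Ideal.IsMaximal.isPrime ‹_›, hw0⟩) (v := v) h2 hv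
  haveI : w.asIdeal.LiesOver v.asIdeal := ⟨(congrArg HeightOneSpectrum.asIdeal heq).symm⟩
  rw [Ideal.ramificationIdx_tower (R := ℤ) v.asIdeal w.asIdeal, ramificationIdx_int_eq_one_of_two_mem v hv, one_mul, h3]

end WeierstrassCurve

end
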